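import Summits.BirchSwinnertonDyer.BirchSwinnertonDyer.Theses.ThetaPartnerAtTwo
import Summits.BirchSwinnertonDyer.BirchSwinnertonDyer.Theses.ResidualThetaTransportAtTwo
import Literature.NumberTheory.EllipticCurves.SupersingularModPDecompositionImageProofs
import HarnessLib

set_option linter.dupNamespace false -- `…BirchSwinnertonDyer.BirchSwinnertonDyer…` is the cell's nested layout (D-0017)
set_option autoImplicit false

/-!
# Item 27793 `SerreSupersingularDecompositionImageInput` (aside alias on routes `ThetaPartnerAtTwo` and
# `ResidualThetaTransportAtTwo`) — Serre 1972, Invent. Math. 15, §1.11 Prop. 12 (c)(d): the mod-`p` image of a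
# decomposition group at a supersingular prime — PROVED BY NAME (LADDER-BSD D-0154 (2), INPUTS desk row 1, by-name sweep)

Seat `bsd-inputs-honda-p1` (gen 13, resident idle INPUTS prover of the desk `pub/bsd-wall/bsd-inputs`), `--workitem`
stmt-BirchSwinnertonDyer-27793; named as prover one-liner (i) in the desk's `INPUTS-LIST-1-v2-DELTA-11.md` §4 (planner
`bsd-inputs-plan-1` g14, 2026-08-28T15:54Z). THEOREMS ONLY (no definition, no named fact, no `sorry`).

The item is the 1:1 alias — stated identically on BOTH habitat routes of row 1 (`ThetaPartnerAtTwo` l.927 and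
`ResidualThetaTransportAtTwo` l.803, HOLD input «Se» of the PUB⁵ bundle `PublishedInputsHeckeAtTwo`, stmt-BirchSwinnertonDyer-27435) — of
the named published fact `Literature.NumberTheory.EllipticCurves.serre1972_supersingular_decompositionSubgroup_image` (Serre 1972
§1.11 Prop. 12 (c), (d) over `ℚ`: for `W/ℚ` elliptic, `p` prime, `v ∣ p` a place of good reduction with `p ∣ a_v`, any framing `ρ̄` of
`E[p](ℚ̄)` and any prime `𝔓 ∣ v` of `ℤ̄`: `ρ̄(I_𝔓)` is cyclic of order `p² − 1` and `#ρ̄(D_𝔓) = 2(p² − 1)`). That fact has been a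
THEOREM of the tree since 2026-08-28T15:41Z: `Literature.NumberTheory.EllipticCurves.serre1972_supersingular_decompositionSubgroup_image_holds`
(module `Literature/NumberTheory/EllipticCurves/SupersingularModPDecompositionImageProofs.lean`, seat `bsd-tp2-w8` g0, p645583, 1 212 l.:
global minimal model, the prime cut out by `placeOver p`, the intrinsic `galoisRepTorsion`, tame Kummer input, Frobenius escape, and §2.2's
`card_eq_two_mul_of_isCyclic_of_le_normalizer`). The bare ledger verb `workitem close … --by <that Literature decl>` is refused by the gate
(«not a declaration of an accepted Summits/<P>/Theorems/ file»), so this leaf file records the discharge against BOTH route declarations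
by `unfold; exact`. Nothing is re-derived; no landed declaration is restated.

Honest framing: UNCONDITIONAL as typed (standard axioms). Closing item 27793 turns the displayed HOLD input «Se» of row 1 (X5 non-CM
`p = 2`: routes TPT / RTT) into a theorem AS TYPED; the bundle `PublishedInputsHeckeAtTwo` (27435) keeps its other printed conjuncts
(Eichler–Shimura / self-dual torsion ⟸ Ihara–Ribet, Buzzard multiplicity one, Abbes–Ullmo); no crux and no summit statement is proved;
the Birch–Swinnerton-Dyer conjecture is NOT proved by any of this.
References: [SerreInventiones1972] §1.11 Prop. 12 (c),(d); §2.1 b); §2.2.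
-/

namespace Summit.BirchSwinnertonDyer.BirchSwinnertonDyer.Theorems.InputsSweep

/-- **Item 27793 on route `ThetaPartnerAtTwo` — `SerreSupersingularDecompositionImageInput` PROVED (by name):** Serre 1972 §1.11
Prop. 12 (c)(d) over `ℚ` (`serre1972_supersingular_decompositionSubgroup_image`, as typed), from the tree's discharge
`serre1972_supersingular_decompositionSubgroup_image_holds`. Unconditional; closes item 27793; BSD is not proved by this.
[cite: SerreInventiones1972, §1.11 Prop. 12 (c),(d); §2.2] -/
theorem thetaPartnerAtTwo_serreSupersingularDecompositionImageInput_proof :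
    Summit.BirchSwinnertonDyer.BirchSwinnertonDyer.Theses.ThetaPartnerAtTwo.SerreSupersingularDecompositionImageInput := by
  unfold Summit.BirchSwinnertonDyer.BirchSwinnertonDyer.Theses.ThetaPartnerAtTwo.SerreSupersingularDecompositionImageInput
  exact Literature.NumberTheory.EllipticCurves.serre1972_supersingular_decompositionSubgroup_image_holds

/-- **Item 27793 on route `ResidualThetaTransportAtTwo` — the same alias, PROVED (by name)** from
`serre1972_supersingular_decompositionSubgroup_image_holds`. Unconditional; BSD is not proved by this.
[cite: SerreInventiones1972, §1.11 Prop. 12 (c),(d); §2.2] -/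
theorem residualThetaTransportAtTwo_serreSupersingularDecompositionImageInput_proof :
    Summit.BirchSwinnertonDyer.BirchSwinnertonDyer.Theses.ResidualThetaTransportAtTwo.SerreSupersingularDecompositionImageInput := by
  unfold Summit.BirchSwinnertonDyer.BirchSwinnertonDyer.Theses.ResidualThetaTransportAtTwo.SerreSupersingularDecompositionImageInput
  exact Literature.NumberTheory.EllipticCurves.serre1972_supersingular_decompositionSubgroup_image_holds

end Summit.BirchSwinnertonDyer.BirchSwinnertonDyer.Theorems.InputsSweep
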